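import Literature.MathematicalPhysics.QuantumFieldTheory.Balaban1983to89.B1TorusChainTransport

/-!
# `Balaban1983to89.B1TorusChainChart` — THE CONTOURS OF [Balaban1983RegularityDecay] (1.9) INSIDE A CUBE `□_j` OF §2 ON THE (Higgs)₂,₃
# TORUS, READ THROUGH THE CUBE CHART: a nearest-neighbour chain of `□_j` is the image of a nearest-neighbour chain of the lineage's box
# (`B4Lemma22HolderBox.IsNNChain`), with the same end point and length, «A(Γ) = Σ_{b⊂Γ} A_b» becomes the lineage's `pathSum` of the box field
# and `U(Ã_j(Γ))` its `transport`; the (1.3)-distance is at most the sup-distance of the box coordinates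

statement-level skeleton of published theorems with citation tags; proofs where landed; nothing here is a claim about the Yang–Mills mass gap

CITATION HEADER (lean-in-tree rule).  T. Bałaban, *Regularity and decay of lattice Green's functions*, Commun. Math. Phys. **89** (1983)
571–597 [Balaban1983RegularityDecay] (p. 572 «A(Γ) = Σ_{b⊂Γ} A_b», (1.4), p. 573 Theorem (1.9), §2 p. 575 the cubes `□_j` and «Ã_j = A₀ +
θ_jA′», p. 576 «A_{b̄} = −A_b», Lemma 2.2 (2.16) p. 578 with the Hölder norm (2.14) p. 577) and T. Bałaban, *(Higgs)₂,₃ quantum fields in a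
finite volume. I*, Commun. Math. Phys. **85** (1982) 603–626 [Balaban1982Higgs1] ((1.3) p. 604, (1.7) p. 605, Prop. 2.1 (2.24) p. 610).  Cell
`lit-balaban` (HOME `run/shared/lean/pub/lit-balaban/`), Phase-2 proof seat **p35** gen 10 (unit `lit-balaban-p35`); SKELETON rows
**B4.Thm@573** ((1.9) on the torus), **B4.Lem2.2** ((2.16) read on the torus cubes), **B1.Prop2.1** ((2.24) at `A ≠ 0`).  USED BY NAME, never
restated: this seat's `B1TorusChainTransport` (`TNbr`, `IsTChain`, `bondVal`, `hol`), gen 8's `B1TorusCubeCover`/`B1TorusCubeChart`/`B1TorusCubeBoxOp`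
(`cube`, `toT`/`fromT`, `toT_add_e1`/`toT_sub_e1`, `add_e1_mem_box_iff`/`sub_e1_mem_box_iff`, `boxCoord`/`chart_boxCoord`, `boxField`, `flowC`,
`ofLp_U`, `boxField_fwd`/`boxField_bwd`), `B1TorusCubeLocality26.cubeVec` (`Ã_j`), the lineage's `B4GaugeCovariance.{pathEnd, transport,
fieldLink}`, `B4Lemma22HolderBox.{pathSum, IsNNChain, transport_fieldLink}`, `B4Reflection242.nbrs`, `B4ContourShift.supNorm`.

WHAT IS PRINTED.  [B4] p. 573: *«for an arbitrary pair of points x, x′ ∈ ηZ^d, let us denote by Γ_{x,x′} a shortest contour connecting these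
points»*, (1.9); p. 575: *«if □_j is an interior cube of Ω, then we take Ã_j as equal to A on the cube {x : |x − Mj| ≤ ¾M} … Ã_j = A₀ +
θ_jA′»*; p. 578: *«If any of the points x, x′ belongs to supp h_j, then both belong to □_j»*.  [B1] p. 604 (1.3), p. 605 (1.7).

WHAT THIS FILE PROVES (kernel-checked, zero `sorry`, theorems only; axioms standard).
* `fromT_shift`/`fromT_unshift` — lattice steps inside `□_j` are box steps `± e_i` of the chart coordinates (`3M ≤ |T_ε|_μ`: no wrap-around);
* `exists_lift` — a chain of sites of `□_j` is the image under `toT` of a list of box sites; `lift_step`; for such a lift: **`isNNChain_lift`**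
  (the lineage's `IsNNChain`), `toT_pathEnd_lift` (end points), `length_lift`;
* **`pathSum_lift`** — `κ·Σ_{steps} boxField = εe·Ã_j(Γ)` along the chain (`κσ = εe`; forward steps `boxField_fwd`, backward steps
  `boxField_bwd` with «A_{b̄} = −A_b»), hence **`transport_lift`** (`transport(fieldLink) = e^{(εe·Ã_j(Γ))q}`) and **`ofLp_hol`**
  (`U(Ã_j(Γ))v` on coordinates is the lineage's `transport` applied to the coordinates of `v`);
* `supNorm_pathEnd_sub_le` (`|z′ − z|_∞ ≤ |Γ|` along a box chain) and **`tdist_le_supNorm_fromT`** (`|x − x′|_{(1.3)} ≤ |fromT x′ − fromT x|_∞`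
  for all sites: each label difference is the class of the coordinate difference and `min{v, S − v} ≤ |difference|`).
HONEST SCOPE: dictionary lemmas only; `Ω = T_ε` with `3M ≤ |T_ε|_μ`, `|T|_μ > 2`; abelian links.  Unit `lit-balaban-p35` gen 10
(literature-prover-lit-balaban-p35-g10-0).
-/

open scoped BigOperators Matrix

noncomputable section

namespace Literature.MathematicalPhysics.QuantumFieldTheory.Balaban1983to89.B1TorusChainChart

open Literature.MathematicalPhysics.QuantumFieldTheory.Balaban1983to89.HiggsLattice
open Literature.MathematicalPhysics.QuantumFieldTheory.Balaban1983to89.HiggsCovariancePos (shift_unshift unshift_shift)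
open Literature.MathematicalPhysics.QuantumFieldTheory.Balaban1983to89.B1TorusCubeCover
open Literature.MathematicalPhysics.QuantumFieldTheory.Balaban1983to89.B1TorusCubeLocality26 (cubeVec cubeVec_apply_of_thetaTor_eq_one)
open Literature.MathematicalPhysics.QuantumFieldTheory.Balaban1983to89.B1TorusCubeChart
open Literature.MathematicalPhysics.QuantumFieldTheory.Balaban1983to89.B1TorusCubeBoxOp (flowC boxField boxField_fwd boxField_bwd ofLp_U)
open Literature.MathematicalPhysics.QuantumFieldTheory.Balaban1983to89.B4GaugeCovariance (fieldLink transport pathEnd)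
open Literature.MathematicalPhysics.QuantumFieldTheory.Balaban1983to89.B4Lemma22HolderBox (pathSum IsNNChain transport_fieldLink)
open Literature.MathematicalPhysics.QuantumFieldTheory.Balaban1983to89.B4Lower18Regular (e1 e1_apply_self e1_apply_ne)
open Literature.MathematicalPhysics.QuantumFieldTheory.Balaban1983to89.B4Lemma22ReduceZero (Box)
open Literature.MathematicalPhysics.QuantumFieldTheory.Balaban1983to89.B4Reflection242 (nbrs mem_nbrs nbrs_comm)
open Literature.MathematicalPhysics.QuantumFieldTheory.Balaban1983to89.B4Lemma22ReduceDeriv (add_e1_mem_nbrs)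
open Literature.MathematicalPhysics.QuantumFieldTheory.Balaban1983to89.B4ContourShift (supNorm supNorm_nonneg abs_le_supNorm)
open Literature.MathematicalPhysics.QuantumFieldTheory.Balaban1983to89.B1TorusChainTransport

variable {P : HiggsLattice.Params} {N : ℕ}

/-! ## Chains of `□_j` under the cube chart: the lineage's `IsNNChain`, `pathSum`, `transport` -/

section Chart

variable {K K₀ : ℕ}

/-- **A forward lattice step inside `□_j` is a box step**: `fromT(x + εe_μ) = fromT x + e_i`, `castD i = μ` (`3M ≤ |T_ε|_μ`: no wrap-around).
[cite: Balaban1983RegularityDecay, §2 p.575] -/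
theorem fromT_shift (hK : K ≤ P.K) (hK₀ : K₀ ∣ P.M) (hK₀' : 1 ≤ K₀) (hN3 : ∀ μ, 3 * half P K K₀ ≤ P.sitesPerDir 0 μ)
    (hh2 : 2 ≤ half P K K₀) (j : Lab P K K₀) {x : HiggsLattice.Site P 0} (hx : x ∈ cube K K₀ j) (μ : Fin P.d)
    (hs : x.shift μ ∈ cube K K₀ j) : fromT K K₀ j (x.shift μ) = fromT K K₀ j x + e1 ((castD P).symm μ) := by
  have hy := (mem_cube_iff hK hK₀ hK₀' j x).1 hx
  have hμ : castD P ((castD P).symm μ) = μ := Equiv.apply_symm_apply _ _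
  have hs' : (toT K K₀ j (fromT K K₀ j x)).shift (castD P ((castD P).symm μ)) ∈ cube K K₀ j := by
    rw [toT_fromT, hμ]; exact hs
  have hy' := (add_e1_mem_box_iff hK hK₀ hK₀' hN3 hh2 j hy ((castD P).symm μ)).2 hs'
  have e : x.shift μ = toT K K₀ j (fromT K K₀ j x + e1 ((castD P).symm μ)) := by
    rw [toT_add_e1, toT_fromT, hμ]
  rw [e, fromT_toT_of_mem hK hK₀ hK₀' j hy']

/-- **A backward lattice step inside `□_j` is a box step**: `fromT(x − εe_μ) = fromT x − e_i`. [cite: Balaban1983RegularityDecay, §2 p.575] -/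
theorem fromT_unshift (hK : K ≤ P.K) (hK₀ : K₀ ∣ P.M) (hK₀' : 1 ≤ K₀) (hN3 : ∀ μ, 3 * half P K K₀ ≤ P.sitesPerDir 0 μ)
    (hh2 : 2 ≤ half P K K₀) (j : Lab P K K₀) {x : HiggsLattice.Site P 0} (hx : x ∈ cube K K₀ j) (μ : Fin P.d)
    (hs : x.unshift μ ∈ cube K K₀ j) : fromT K K₀ j (x.unshift μ) = fromT K K₀ j x - e1 ((castD P).symm μ) := by
  have hy := (mem_cube_iff hK hK₀ hK₀' j x).1 hx
  have hμ : castD P ((castD P).symm μ) = μ := Equiv.apply_symm_apply _ _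
  have hs' : (toT K K₀ j (fromT K K₀ j x)).unshift (castD P ((castD P).symm μ)) ∈ cube K K₀ j := by
    rw [toT_fromT, hμ]; exact hs
  have hy' := (sub_e1_mem_box_iff hK hK₀ hK₀' hN3 hh2 j hy ((castD P).symm μ)).2 hs'
  have e : x.unshift μ = toT K K₀ j (fromT K K₀ j x - e1 ((castD P).symm μ)) := by
    rw [toT_sub_e1, toT_fromT, hμ]
  rw [e, fromT_toT_of_mem hK hK₀ hK₀' j hy']

/-- A chain of sites of `□_j` is the image under the chart of a list of box sites. [cite: Balaban1983RegularityDecay, §2 p.575] -/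
theorem exists_lift (hK : K ≤ P.K) (hK₀ : K₀ ∣ P.M) (hK₀' : 1 ≤ K₀) (j : Lab P K K₀) (l : List (HiggsLattice.Site P 0))
    (hl : ∀ y ∈ l, y ∈ cube K K₀ j) :
    ∃ lB : List ↥(Box (dd P) (P.L - 1) K (M2 P K₀)), lB.map (fun z => toT K K₀ j z.1) = l := by
  induction l with
  | nil => exact ⟨[], rfl⟩
  | cons y l ih =>
      obtain ⟨lB, hlB⟩ := ih (fun z hz => hl z (List.mem_cons_of_mem _ hz))
      refine ⟨⟨fromT K K₀ j y, (mem_cube_iff hK hK₀ hK₀' j y).1 (hl y (by simp))⟩ :: lB, ?_⟩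
      simp [toT_fromT, hlB]

/-- ONE STEP OF A LIFTED CHAIN: if `toT z = x`, `toT z′ = y` (box sites) and `x`, `y` are torus neighbours, then either `y = x + εe_{castD i}`,
`z′ = z + e_i`, or `x = y + εe_{castD i}`, `z = z′ + e_i`. [cite: Balaban1983RegularityDecay, §2 p.575] -/
theorem lift_step (hK : K ≤ P.K) (hK₀ : K₀ ∣ P.M) (hK₀' : 1 ≤ K₀) (hN3 : ∀ μ, 3 * half P K K₀ ≤ P.sitesPerDir 0 μ)
    (hh2 : 2 ≤ half P K K₀) (j : Lab P K K₀) {z z' : ↥(Box (dd P) (P.L - 1) K (M2 P K₀))} {x y : HiggsLattice.Site P 0}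
    (hz : toT K K₀ j z.1 = x) (hz' : toT K K₀ j z'.1 = y) (hxy : TNbr x y) :
    (∃ i, y = x.shift (castD P i) ∧ z'.1 = z.1 + e1 i) ∨ (∃ i, x = y.shift (castD P i) ∧ z.1 = z'.1 + e1 i) := by
  have hxc : x ∈ cube K K₀ j := by rw [← hz]; exact toT_mem_cube hK hK₀ hK₀' j z.2
  have hyc : y ∈ cube K K₀ j := by rw [← hz']; exact toT_mem_cube hK hK₀ hK₀' j z'.2
  have hfx : fromT K K₀ j x = z.1 := by rw [← hz, fromT_toT_of_mem hK hK₀ hK₀' j z.2]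
  have hfy : fromT K K₀ j y = z'.1 := by rw [← hz', fromT_toT_of_mem hK hK₀ hK₀' j z'.2]
  obtain ⟨μ, h | h⟩ := hxy
  · refine Or.inl ⟨(castD P).symm μ, by rw [Equiv.apply_symm_apply]; exact h, ?_⟩
    rw [← hfy, ← hfx, h]
    exact fromT_shift hK hK₀ hK₀' hN3 hh2 j hxc μ (h ▸ hyc)
  · refine Or.inr ⟨(castD P).symm μ, by rw [Equiv.apply_symm_apply]; exact h, ?_⟩
    rw [← hfy, ← hfx, h]
    exact fromT_shift hK hK₀ hK₀' hN3 hh2 j hyc μ (h ▸ hxc)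

/-- **The lift of a contour of `□_j` is a nearest-neighbour chain of the box.** [cite: Balaban1983RegularityDecay, §2 p.575, (1.9) p.573] -/
theorem isNNChain_lift (hK : K ≤ P.K) (hK₀ : K₀ ∣ P.M) (hK₀' : 1 ≤ K₀) (hN3 : ∀ μ, 3 * half P K K₀ ≤ P.sitesPerDir 0 μ)
    (hh2 : 2 ≤ half P K K₀) (j : Lab P K K₀) :
    ∀ (lB : List ↥(Box (dd P) (P.L - 1) K (M2 P K₀))) (z : ↥(Box (dd P) (P.L - 1) K (M2 P K₀))) (x : HiggsLattice.Site P 0),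
      toT K K₀ j z.1 = x → IsTChain x (lB.map fun w => toT K K₀ j w.1) → IsNNChain z lB := by
  intro lB
  induction lB with
  | nil => intro z x _ _; exact trivial
  | cons w lB ih =>
      intro z x hz hch
      obtain ⟨hxy, hrest⟩ := hch
      refine ⟨?_, ih w _ rfl hrest⟩
      rcases lift_step hK hK₀ hK₀' hN3 hh2 j hz rfl hxy with ⟨i, -, e⟩ | ⟨i, -, e⟩
      · rw [e]; exact add_e1_mem_nbrs _ _
      · rw [nbrs_comm, e]; exact add_e1_mem_nbrs _ _

/-- The chart carries end points to end points. [cite: Balaban1983RegularityDecay, §2 p.575] -/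
theorem toT_pathEnd_lift (j : Lab P K K₀) :
    ∀ (lB : List ↥(Box (dd P) (P.L - 1) K (M2 P K₀))) (z : ↥(Box (dd P) (P.L - 1) K (M2 P K₀))),
      toT K K₀ j (pathEnd z lB).1 = pathEnd (toT K K₀ j z.1) (lB.map fun w => toT K K₀ j w.1) := by
  intro lB
  induction lB with
  | nil => intro z; rfl
  | cons w lB ih => intro z; exact ih w

/-- The lift has the length of the contour. [cite: Balaban1983RegularityDecay, (1.9) p.573] -/
theorem length_lift (j : Lab P K K₀) (lB : List ↥(Box (dd P) (P.L - 1) K (M2 P K₀))) :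
    (lB.map fun w => toT K K₀ j w.1).length = lB.length := List.length_map _

/-- **«A(Γ) = Σ_{b⊂Γ} A_b» UNDER THE CHART**: along a contour of `□_j`, `κ·Σ_{steps} boxField = εe·Ã_j(Γ)` when `κσ = εe` (forward steps by
`boxField_fwd`, backward ones by `boxField_bwd` and «A_{b̄} = −A_b»). [cite: Balaban1983RegularityDecay, p.572, p.576, §2 p.575] -/
theorem pathSum_lift (C : ChargeData N) (hK : K ≤ P.K) (hK₀ : K₀ ∣ P.M) (hK₀' : 1 ≤ K₀) (hN3 : ∀ μ, 3 * half P K K₀ ≤ P.sitesPerDir 0 μ)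
    (hh2 : 2 ≤ half P K K₀) (hS : ∀ μ, 2 < P.sitesPerDir 0 μ) (j : Lab P K K₀) {κ σ : ℝ} (hκσ : κ * σ = P.mesh 0 * C.e)
    (A : HiggsLattice.VecField P 0) :
    ∀ (lB : List ↥(Box (dd P) (P.L - 1) K (M2 P K₀))) (z : ↥(Box (dd P) (P.L - 1) K (M2 P K₀))) (x : HiggsLattice.Site P 0),
      toT K K₀ j z.1 = x → IsTChain x (lB.map fun w => toT K K₀ j w.1) →
        κ * pathSum (boxField K K₀ j σ A) z lB = P.mesh 0 * C.e * pathSum (bondVal (cubeVec K K₀ j A)) x (lB.map fun w => toT K K₀ j w.1) := by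
  intro lB
  induction lB with
  | nil => intro z x _ _; simp [pathSum]
  | cons w lB ih =>
      intro z x hz hch
      obtain ⟨hxy, hrest⟩ := hch
      simp only [List.map_cons, pathSum, mul_add]
      rw [ih w _ rfl hrest]
      congr 1
      rcases lift_step hK hK₀ hK₀' hN3 hh2 j hz rfl hxy with ⟨i, e, hw⟩ | ⟨i, e, hw⟩
      · rw [boxField_fwd hK hK₀ hK₀' j C hκσ A hw, hz, e, bondVal_shift hS]
      · rw [boxField_bwd hK hK₀ hK₀' j C hκσ A hw, e, bondVal_of_shift hS, mul_neg]

/-- **`U(Ã_j(Γ))` UNDER THE CHART is the lineage's `transport` along the lifted chain** (abelian links: `transport = U(κ·ΣboxField)`).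
[cite: Balaban1983RegularityDecay, (1.4) p.572] [cite: Balaban1982Higgs1, (1.7) p.605] -/
theorem transport_lift (C : ChargeData N) (hK : K ≤ P.K) (hK₀ : K₀ ∣ P.M) (hK₀' : 1 ≤ K₀) (hN3 : ∀ μ, 3 * half P K K₀ ≤ P.sitesPerDir 0 μ)
    (hh2 : 2 ≤ half P K K₀) (hS : ∀ μ, 2 < P.sitesPerDir 0 μ) (j : Lab P K K₀) {κ σ : ℝ} (hκσ : κ * σ = P.mesh 0 * C.e)
    (A : HiggsLattice.VecField P 0) (lB : List ↥(Box (dd P) (P.L - 1) K (M2 P K₀))) (z : ↥(Box (dd P) (P.L - 1) K (M2 P K₀)))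
    {x : HiggsLattice.Site P 0} (hz : toT K K₀ j z.1 = x) (hch : IsTChain x (lB.map fun w => toT K K₀ j w.1)) :
    transport (fieldLink (flowC C) κ (boxField K K₀ j σ A)) z lB
      = (flowC C).U (P.mesh 0 * C.e * pathSum (bondVal (cubeVec K K₀ j A)) x (lB.map fun w => toT K K₀ j w.1)) := by
  rw [transport_fieldLink, pathSum_lift C hK hK₀ hK₀' hN3 hh2 hS j hκσ A lB z x hz hch]

/-- **`U(Ã_j(Γ))v` ON COORDINATES `= transport · v`**. [cite: Balaban1983RegularityDecay, (1.4) p.572, (1.9) p.573] [cite: Balaban1982Higgs1, (1.7) p.605] -/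
theorem ofLp_hol (C : ChargeData N) (hK : K ≤ P.K) (hK₀ : K₀ ∣ P.M) (hK₀' : 1 ≤ K₀) (hN3 : ∀ μ, 3 * half P K K₀ ≤ P.sitesPerDir 0 μ)
    (hh2 : 2 ≤ half P K K₀) (hS : ∀ μ, 2 < P.sitesPerDir 0 μ) (j : Lab P K K₀) {κ σ : ℝ} (hκσ : κ * σ = P.mesh 0 * C.e)
    (A : HiggsLattice.VecField P 0) (lB : List ↥(Box (dd P) (P.L - 1) K (M2 P K₀))) (z : ↥(Box (dd P) (P.L - 1) K (M2 P K₀)))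
    {x : HiggsLattice.Site P 0} (hz : toT K K₀ j z.1 = x) (hch : IsTChain x (lB.map fun w => toT K K₀ j w.1))
    (v : EuclideanSpace ℝ (Fin N)) :
    WithLp.ofLp (hol C (cubeVec K K₀ j A) x (lB.map fun w => toT K K₀ j w.1) v)
      = transport (fieldLink (flowC C) κ (boxField K K₀ j σ A)) z lB *ᵥ WithLp.ofLp v := by
  rw [transport_lift C hK hK₀ hK₀' hN3 hh2 hS j hκσ A lB z hz hch]
  unfold hol
  rw [ofLp_U]

/-- Along a nearest-neighbour chain of the box the sup-distance of the end point from the start is at most the length.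
[cite: Balaban1983RegularityDecay, p.573 «a shortest contour»] -/
theorem supNorm_pathEnd_sub_le {R : Finset (Fin (dd P + 1) → ℤ)} :
    ∀ (lB : List ↥R) (z : ↥R), IsNNChain z lB → supNorm ((pathEnd z lB).1 - z.1) ≤ lB.length := by
  intro lB
  induction lB with
  | nil =>
      intro z _
      simp only [pathEnd, sub_self, List.length_nil, Nat.cast_zero]
      unfold supNorm
      refine Finset.sup'_le _ _ fun i _ => by simp
  | cons w lB ih =>
      intro z hch
      obtain ⟨hw, hrest⟩ := hch
      have hih := ih w hrest
      simp only [pathEnd, List.length_cons, Nat.cast_succ]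
      unfold supNorm at hih ⊢
      refine Finset.sup'_le _ _ fun i _ => ?_
      have h1 : ((|((pathEnd w lB).1 - w.1) i| : ℤ) : ℝ) ≤ lB.length :=
        (Finset.le_sup' (fun i => ((|((pathEnd w lB).1 - w.1) i| : ℤ) : ℝ)) (Finset.mem_univ i)).trans hih
      have h2 : |(w.1 - z.1) i| ≤ 1 := by
        obtain ⟨i', hi' | hi'⟩ := mem_nbrs.mp hw
        · rw [hi', add_sub_cancel_left]
          by_cases h : i = i'
          · subst h; simp
          · rw [Pi.single_eq_of_ne h]; simp
        · rw [hi', sub_sub_cancel_left, Pi.neg_apply, abs_neg]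
          by_cases h : i = i'
          · subst h; simp
          · rw [Pi.single_eq_of_ne h]; simp
      have h3 : |((pathEnd w lB).1 - z.1) i| ≤ |((pathEnd w lB).1 - w.1) i| + |(w.1 - z.1) i| := by
        have : ((pathEnd w lB).1 - z.1) i = ((pathEnd w lB).1 - w.1) i + (w.1 - z.1) i := by simp
        rw [this]; exact abs_add_le _ _
      have h2' : ((|(w.1 - z.1) i| : ℤ) : ℝ) ≤ 1 := by exact_mod_cast h2
      have h3' : ((|((pathEnd w lB).1 - z.1) i| : ℤ) : ℝ) ≤ ((|((pathEnd w lB).1 - w.1) i| : ℤ) : ℝ) + ((|(w.1 - z.1) i| : ℤ) : ℝ) := by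
        exact_mod_cast h3
      linarith

/-- **THE (1.3)-DISTANCE IS AT MOST THE SUP-DISTANCE OF THE BOX COORDINATES**: `|x − x′| ≤ |fromT x′ − fromT x|_∞` (each coordinate
difference of the torus labels is the class of the coordinate difference, and `min{v, S − v} ≤ |difference|`).
[cite: Balaban1982Higgs1, (1.3) p.604] [cite: Balaban1983RegularityDecay, §2 p.575] -/
theorem tdist_le_supNorm_fromT (j : Lab P K K₀) (x x' : HiggsLattice.Site P 0) :
    (HiggsLattice.Site.tdist x x' : ℝ) ≤ supNorm (fromT K K₀ j x' - fromT K K₀ j x) := by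
  -- the torus labels as classes of the box coordinates
  have hrep : ∀ (y : HiggsLattice.Site P 0) (μ : Fin P.d),
      y μ = ((ctr K K₀ j μ - half P K K₀ + boxCoord K K₀ j y μ : ℤ) : ZMod (P.sitesPerDir 0 μ)) := by
    intro y μ
    have e := congrFun (chart_boxCoord (K := K) (K₀ := K₀) j y) μ
    unfold chart at e
    exact e.symm
  -- coordinatewise: `min ≤ |b′ − b|`
  have hco : ∀ μ, ((min (x μ - x' μ).val (x' μ - x μ).val : ℕ) : ℝ) ≤ ((|boxCoord K K₀ j x' μ - boxCoord K K₀ j x μ| : ℤ) : ℝ) := by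
    intro μ
    set b := boxCoord K K₀ j x μ
    set b' := boxCoord K K₀ j x' μ
    have hsub : x μ - x' μ = ((b - b' : ℤ) : ZMod (P.sitesPerDir 0 μ)) := by rw [hrep x μ, hrep x' μ]; push_cast; ring
    have hsub' : x' μ - x μ = ((b' - b : ℤ) : ZMod (P.sitesPerDir 0 μ)) := by rw [hrep x μ, hrep x' μ]; push_cast; ring
    rcases le_or_gt b' b with hle | hlt
    · obtain ⟨n, hn⟩ := Int.eq_ofNat_of_zero_le (sub_nonneg.mpr hle)
      have hval : (x μ - x' μ).val = n % P.sitesPerDir 0 μ := by rw [hsub, hn, Int.cast_natCast, ZMod.val_natCast]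
      have h1 : (min (x μ - x' μ).val (x' μ - x μ).val : ℕ) ≤ n :=
        (min_le_left _ _).trans (by rw [hval]; exact Nat.mod_le _ _)
      have h2 : ((n : ℕ) : ℤ) = |b' - b| := by rw [abs_sub_comm, abs_of_nonneg (sub_nonneg.mpr hle), hn]
      have h1' : ((min (x μ - x' μ).val (x' μ - x μ).val : ℕ) : ℝ) ≤ ((n : ℤ) : ℝ) := by exact_mod_cast h1
      rw [h2] at h1'
      exact_mod_cast h1'
    · obtain ⟨n, hn⟩ := Int.eq_ofNat_of_zero_le (sub_nonneg.mpr hlt.le)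
      have hval : (x' μ - x μ).val = n % P.sitesPerDir 0 μ := by rw [hsub', hn, Int.cast_natCast, ZMod.val_natCast]
      have h1 : (min (x μ - x' μ).val (x' μ - x μ).val : ℕ) ≤ n :=
        (min_le_right _ _).trans (by rw [hval]; exact Nat.mod_le _ _)
      have h2 : ((n : ℕ) : ℤ) = |b' - b| := by rw [abs_of_nonneg (sub_nonneg.mpr hlt.le), hn]
      have h1' : ((min (x μ - x' μ).val (x' μ - x μ).val : ℕ) : ℝ) ≤ ((n : ℤ) : ℝ) := by exact_mod_cast h1
      rw [h2] at h1'
      exact_mod_cast h1'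
  -- the maximum over the directions
  unfold HiggsLattice.Site.tdist
  haveI : Nonempty (Fin P.d) := ⟨⟨0, P.hd⟩⟩
  obtain ⟨μ, -, hμ⟩ := Finset.exists_mem_eq_sup (Finset.univ : Finset (Fin P.d)) Finset.univ_nonempty
    (fun μ => min (x μ - x' μ).val (x' μ - x μ).val)
  rw [hμ]
  refine (hco μ).trans ?_
  have e : boxCoord K K₀ j x' μ - boxCoord K K₀ j x μ = (fromT K K₀ j x' - fromT K K₀ j x) ((castD P).symm μ) := by
    simp [fromT]
  rw [e]
  exact abs_le_supNorm _ _

end Chart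

end Literature.MathematicalPhysics.QuantumFieldTheory.Balaban1983to89.B1TorusChainChart
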